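import Summits.HodgeConjecture.CorCM.Census.CoverClosureMeta

/-!
# The square-central class, III: swap calculus — deviation sets under base change, stabilised transversal types, the four-type metric

COR-CM (cell `pub-hodgecm2`), count-neutral kernel combinatorics by the binder seat b09 (gen 45; lane SQUARE-CENTRAL CLASS, part III), model-free
bookkeeping relative to a base type `T₀`, on the intrinsic currency of `CorCM/Prior/AllgGroup1.lean` and `Census/BlockParityLaw.lean` (`rt`, `mem_rt`,
`rt_self_val`), `Census/TwistGenerationModel.lean` (`ddist`) and `Census/BaseBlockCovering.lean` (`bpot`), all BY NAME.  Theorems only: no definition, no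
`decide`, no certificate, no named fact, no `sorry`.  HONEST FRAMING: `HC_CM` is NOT proved, here or anywhere in the tree; nothing here is a period or a headline.

Every place `{x, c·x}` has exactly one representative in the base type `T₀`; a type `Φ` is recorded by its DEVIATION SET `D(Φ) = T₀ ∖ Φ ⊆ T₀` (the places where
it differs from `T₀`), and `Φ = Ψ ↔ D(Φ) = D(Ψ)` (`eq_of_dev_eq`).

* §1 **Distances are symmetric differences** (`ddist_eq_card_symmDiff`): `ddist X Φ = |D(X) ∆ D(Φ)|`.
* §2 **Deviation sets under base change** (`mem_dev_rt_iff`): for `t ∈ T₀` and `t'` the `T₀`-representative of the place of `t·Q`,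
  `t ∈ D(Φ·Q⁻¹) ↔ (t' ∈ D(Φ)) XOR (t ∈ D(T₀·Q⁻¹))` — the place permutation `σ_Q : t ↦ t'` followed by the symmetric difference with the deviation set of
  the moved base type.
* §3 **Stabilised types** (`rt_eq_self_of_transversal`): if `D(T₀·Q⁻¹) = 𝓗` and `σ_Q` preserves `𝓗`, every type whose deviation set is `T ∪ A` with `T ⊆ 𝓗` a
  TRANSVERSAL of `σ_Q` on `𝓗` (`t ∈ T ↔ σ_Q t ∉ T`) and `A ⊆ T₀ ∖ 𝓗` `σ_Q`-stable is FIXED by the base change `Q` — the stabilised tie types of the lane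
  (`A = ∅`: level `m`; `A = {a, σ_Q a}`: level `m + 2`).
* §4 **The four-type metric**: when the base block is `{T₀, T̄₀, T₁, T̄₁}` (`hbase`) with `𝓗 = D(T₁)`, the four distances of `Φ` are `|D|`, `n − |D|`,
  `|𝓗 ∆ D|`, `n − |𝓗 ∆ D|` (`n = |T₀|`); criteria for `T₀` resp. `T₁` to be the UNIQUE nearest base change (`bpot_eq_card_dev_of_le`, `unique_T₀_of_lt`,
  `bpot_eq_card_symmDiff_of_le`, `unique_T₁_of_lt`) — the strictness inputs of part I.

## References
* [Pohlmann1968] H. Pohlmann, Algebraic cycles on abelian varieties of complex multiplication type, Ann. of Math. 88 (1968), Thm 1.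
-/

namespace Summit.HodgeConjecture.CorCM.Census.CentralSquares

open Finset
open scoped symmDiff
open Summit.HodgeConjecture.CorCM.Prior.AllgGroup.RfwfAllgGroup
open Summit.HodgeConjecture.CorCM.Census.BlockParity
open Summit.HodgeConjecture.CorCM.Census.Coinvariant
open Summit.HodgeConjecture.CorCM.Census.TwistGeneration
open Summit.HodgeConjecture.CorCM.Census.BaseBlock

noncomputable section

variable {G : Type*} [Group G] [Fintype G] [DecidableEq G] (c : G) (T₀ : CMF G c)

/-! ## §0 Places and their representatives in `T₀` -/

omit [Fintype G] [DecidableEq G] T₀ in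
/-- **Every place has a representative in a CM type `T`**: some `t' ∈ T` with `t' = x` or `t' = c·x`. [folklore] -/
theorem exists_rep {T : Finset G} (hT : IsCMF c T) (x : G) : ∃ t' ∈ T, t' = x ∨ t' = c * x := by
  by_cases hx : x ∈ T
  · exact ⟨x, hx, Or.inl rfl⟩
  · exact ⟨c * x, by by_contra h; exact hx ((hT x).mpr h), Or.inr rfl⟩

/-- **A type is determined by its deviation set from `T₀`.** [folklore] -/
theorem eq_of_dev_eq {Φ Ψ : CMF G c} (h : T₀.1 \ Φ.1 = T₀.1 \ Ψ.1) : Φ = Ψ := by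
  apply Subtype.ext
  ext x
  by_cases hx : x ∈ T₀.1
  · have h1 : x ∉ T₀.1 \ Φ.1 ↔ x ∉ T₀.1 \ Ψ.1 := by rw [h]
    rw [mem_sdiff, mem_sdiff] at h1
    tauto
  · have hcx : c * x ∈ T₀.1 := by by_contra h; exact hx ((T₀.2 x).mpr h)
    have h1 : c * x ∈ T₀.1 \ Φ.1 ↔ c * x ∈ T₀.1 \ Ψ.1 := by rw [h]
    rw [mem_sdiff, mem_sdiff] at h1
    have hΦ := Φ.2 x
    have hΨ := Ψ.2 x
    tauto

/-! ## §1 Distances are symmetric differences of deviation sets -/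

/-- **`ddist X Φ = |D(X) ∆ D(Φ)|`**: the number of places where `X` and `Φ` differ, read off their deviation sets from `T₀`. [folklore] -/
theorem ddist_eq_card_symmDiff (hc2 : c * c = 1) (X Φ : CMF G c) :
    ddist X Φ = ((T₀.1 \ X.1) ∆ (T₀.1 \ Φ.1)).card := by
  unfold ddist
  -- inside `T₀`: `(X ∖ Φ) ∩ T₀ = D(Φ) ∖ D(X)`; outside: `c·((X ∖ Φ) ∖ T₀) = D(X) ∖ D(Φ)`
  have hin : (X.1 \ Φ.1).filter (fun x => x ∈ T₀.1) = (T₀.1 \ Φ.1) \ (T₀.1 \ X.1) := by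
    ext t
    simp only [mem_filter, mem_sdiff, not_and, not_not]
    tauto
  have hout : ((X.1 \ Φ.1).filter (fun x => x ∉ T₀.1)).image (fun x => c * x) = (T₀.1 \ X.1) \ (T₀.1 \ Φ.1) := by
    ext t
    simp only [mem_image, mem_filter, mem_sdiff, not_and, not_not]
    constructor
    · rintro ⟨x, ⟨⟨hxX, hxΦ⟩, hxT⟩, rfl⟩
      refine ⟨⟨by by_contra h; exact hxT ((T₀.2 x).mpr h), (X.2 x).mp hxX⟩, fun _ => ?_⟩
      exact (Φ.2 (c * x)).mpr (by rw [cmul_cmul c hc2]; exact hxΦ)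
    · rintro ⟨⟨htT, htX⟩, himp⟩
      have htΦ : t ∈ Φ.1 := himp htT
      refine ⟨c * t, ⟨⟨?_, (Φ.2 t).mp htΦ⟩, (T₀.2 t).mp htT⟩, cmul_cmul c hc2 t⟩
      by_contra h
      exact htX ((X.2 t).mpr h)
  rw [← card_filter_add_card_filter_not (s := X.1 \ Φ.1) (fun x => x ∈ T₀.1), hin,
    ← card_image_of_injective ((X.1 \ Φ.1).filter (fun x => x ∉ T₀.1)) (mul_right_injective c), hout,
    symmDiff_comm, symmDiff_def, sup_eq_union, card_union_of_disjoint disjoint_sdiff_sdiff]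

/-- The distance from the base type is the size of the deviation set. [folklore] -/
theorem ddist_base_eq (X : CMF G c) : ddist T₀ X = (T₀.1 \ X.1).card := rfl

/-- The distance from the COMPLEMENT of the base type (central `c`): `ddist T̄₀ X = |T₀| − |D(X)|`. [folklore] -/
theorem ddist_compl_base_eq (hc2 : c * c = 1) (hcen : ∀ x : G, x * c = c * x) (X : CMF G c) :
    ddist (rt c c T₀) X = T₀.1.card - (T₀.1 \ X.1).card := by
  have hD : T₀.1 \ (rt c c T₀).1 = T₀.1 := by
    ext t
    rw [mem_sdiff, rt_self_val c hcen, mem_sdiff]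
    simp only [mem_univ, true_and, not_not, and_iff_left_iff_imp]
    exact id
  rw [ddist_eq_card_symmDiff c T₀ hc2, hD, symmDiff_of_ge (sdiff_subset : T₀.1 \ X.1 ⊆ T₀.1),
    card_sdiff_of_subset (sdiff_subset : T₀.1 \ X.1 ⊆ T₀.1)]

/-- The distance from the complement `T̄₁`: `ddist T̄₁ X = |T₀| − |𝓗 ∆ D(X)|` (central `c`). [folklore] -/
theorem ddist_compl_eq (hc2 : c * c = 1) (hcen : ∀ x : G, x * c = c * x) (T₁ X : CMF G c) :
    ddist (rt c c T₁) X = T₀.1.card - ((T₀.1 \ T₁.1) ∆ (T₀.1 \ X.1)).card := by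
  have hD : T₀.1 \ (rt c c T₁).1 = T₀.1 \ (T₀.1 \ T₁.1) := by
    ext t
    rw [mem_sdiff, rt_self_val c hcen, mem_sdiff, mem_sdiff, mem_sdiff]
    simp only [mem_univ, true_and, not_not, not_and]
    tauto
  -- `(T₀ ∖ 𝓗) ∆ D = T₀ ∖ (𝓗 ∆ D)` for `𝓗, D ⊆ T₀`
  have e : (T₀.1 \ (T₀.1 \ T₁.1)) ∆ (T₀.1 \ X.1) = T₀.1 \ ((T₀.1 \ T₁.1) ∆ (T₀.1 \ X.1)) := by
    ext t
    simp only [mem_symmDiff, mem_sdiff, not_and, not_not]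
    tauto
  have hsub : (T₀.1 \ T₁.1) ∆ (T₀.1 \ X.1) ⊆ T₀.1 := by
    intro t ht
    rw [mem_symmDiff, mem_sdiff, mem_sdiff] at ht
    tauto
  rw [ddist_eq_card_symmDiff c T₀ hc2, hD, e, card_sdiff_of_subset hsub]

/-! ## §2 Deviation sets under base change -/

/-- **Deviation sets under base change.**  For `t ∈ T₀` and `t' ∈ T₀` the representative of the place of `t·Q`:
`t ∈ D(Φ·Q⁻¹) ↔ (t' ∈ D(Φ)) XOR (t ∈ D(T₀·Q⁻¹))`. [folklore] -/
theorem mem_dev_rt_iff (Φ : CMF G c) (Q : G) {t t' : G} (ht : t ∈ T₀.1) (ht' : t' ∈ T₀.1)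
    (h : t' = t * Q ∨ t' = c * (t * Q)) :
    t ∈ T₀.1 \ (rt c Q Φ).1 ↔ Xor (t' ∈ T₀.1 \ Φ.1) (t ∈ T₀.1 \ (rt c Q T₀).1) := by
  simp only [mem_sdiff, mem_rt, Xor]
  rcases h with rfl | rfl
  · -- `t·Q ∈ T₀`
    tauto
  · -- `t·Q ∉ T₀`
    have hn : t * Q ∉ T₀.1 := fun h => (T₀.2 (t * Q)).mp h ht'
    have hΦ := Φ.2 (t * Q)
    tauto

/-! ## §3 Stabilised transversal types -/

/-- **STABILISED TYPES.**  Let the base change `Q` move `T₀` to the type with deviation set `𝓗` and let its place permutation preserve `𝓗`.  A type whose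
deviation set is `T ∪ A` with `T ⊆ 𝓗` a transversal of the place permutation on `𝓗` and `A ⊆ T₀ ∖ 𝓗` stable under it, is fixed by `Q`. [folklore] -/
theorem rt_eq_self_of_transversal (Q : G) (H : Finset G) (hQ : T₀.1 \ (rt c Q T₀).1 = H)
    (hσH : ∀ t ∈ T₀.1, ∀ t' ∈ T₀.1, (t' = t * Q ∨ t' = c * (t * Q)) → (t ∈ H ↔ t' ∈ H))
    (Φ : CMF G c) (T A : Finset G) (hdev : T₀.1 \ Φ.1 = T ∪ A) (hTH : T ⊆ H) (hA : A ⊆ T₀.1 \ H)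
    (hT : ∀ t ∈ H, ∀ t' ∈ T₀.1, (t' = t * Q ∨ t' = c * (t * Q)) → (t ∈ T ↔ t' ∉ T))
    (hAσ : ∀ t ∈ T₀.1 \ H, ∀ t' ∈ T₀.1, (t' = t * Q ∨ t' = c * (t * Q)) → (t ∈ A ↔ t' ∈ A)) :
    rt c Q Φ = Φ := by
  have hH : H ⊆ T₀.1 := by rw [← hQ]; exact sdiff_subset
  refine eq_of_dev_eq c T₀ ?_
  rw [hdev]
  ext t
  by_cases ht : t ∈ T₀.1
  · obtain ⟨t', ht', h⟩ := exists_rep c T₀.2 (t * Q)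
    rw [mem_dev_rt_iff c T₀ Φ Q ht ht' h, hQ, hdev, mem_union, mem_union]
    by_cases htH : t ∈ H
    · have ht'H : t' ∈ H := (hσH t ht t' ht' h).mp htH
      have ht'A : t' ∉ A := fun hh => (mem_sdiff.mp (hA hh)).2 ht'H
      have htA : t ∉ A := fun hh => (mem_sdiff.mp (hA hh)).2 htH
      have key := hT t htH t' ht' h
      simp only [Xor, htH, ht'A, htA, or_false, not_true, and_false, false_or]
      tauto
    · have ht'H : t' ∉ H := fun hh => htH ((hσH t ht t' ht' h).mpr hh)
      have ht'T : t' ∉ T := fun hh => ht'H (hTH hh)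
      have htT : t ∉ T := fun hh => htH (hTH hh)
      have key := hAσ t (mem_sdiff.mpr ⟨ht, htH⟩) t' ht' h
      simp only [Xor, htH, ht'T, htT, false_or]
      tauto
  · have h1 : t ∉ T₀.1 \ (rt c Q Φ).1 := fun hh => ht (mem_sdiff.mp hh).1
    have h2 : t ∉ T ∪ A := by
      rw [mem_union]; rintro (hh | hh)
      · exact ht (hH (hTH hh))
      · exact ht (mem_sdiff.mp (hA hh)).1
    exact ⟨fun hh => absurd hh h1, fun hh => absurd hh h2⟩

/-! ## §4 The four-type metric -/

section Four

variable (T₁ : CMF G c)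
variable (hbase : ∀ Q : G, rt c Q T₀ = T₀ ∨ rt c Q T₀ = rt c c T₀ ∨ rt c Q T₀ = T₁ ∨ rt c Q T₀ = rt c c T₁)

include hbase in
/-- **The four distances.**  With base block `{T₀, T̄₀, T₁, T̄₁}`, the distance from any base change of `T₀` to `X` is one of `|D|`, `n − |D|`, `|𝓗 ∆ D|`,
`n − |𝓗 ∆ D|` (`D = D(X)`, `𝓗 = D(T₁)`, `n = |T₀|`). [folklore] -/
theorem ddist_rt_base_cases (hc2 : c * c = 1) (hcen : ∀ x : G, x * c = c * x) (Q : G) (X : CMF G c) :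
    ddist (rt c Q T₀) X = (T₀.1 \ X.1).card ∨ ddist (rt c Q T₀) X = T₀.1.card - (T₀.1 \ X.1).card ∨
      ddist (rt c Q T₀) X = ((T₀.1 \ T₁.1) ∆ (T₀.1 \ X.1)).card ∨
      ddist (rt c Q T₀) X = T₀.1.card - ((T₀.1 \ T₁.1) ∆ (T₀.1 \ X.1)).card := by
  rcases hbase Q with h | h | h | h <;> rw [h]
  · exact Or.inl rfl
  · exact Or.inr (Or.inl (ddist_compl_base_eq c T₀ hc2 hcen X))
  · exact Or.inr (Or.inr (Or.inl (ddist_eq_card_symmDiff c T₀ hc2 T₁ X)))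
  · exact Or.inr (Or.inr (Or.inr (ddist_compl_eq c T₀ hc2 hcen T₁ X)))

include hbase in
/-- **`T₀` nearest**: if `|D| ≤ n − |D|`, `|D| ≤ |𝓗 ∆ D|`, `|D| ≤ n − |𝓗 ∆ D|` then `bpot X = |D| = ddist T₀ X`. [folklore] -/
theorem bpot_eq_card_dev_of_le (hc2 : c * c = 1) (hcen : ∀ x : G, x * c = c * x) (X : CMF G c)
    (h1 : (T₀.1 \ X.1).card ≤ T₀.1.card - (T₀.1 \ X.1).card)
    (h2 : (T₀.1 \ X.1).card ≤ ((T₀.1 \ T₁.1) ∆ (T₀.1 \ X.1)).card)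
    (h3 : (T₀.1 \ X.1).card ≤ T₀.1.card - ((T₀.1 \ T₁.1) ∆ (T₀.1 \ X.1)).card) :
    bpot c T₀ X = (T₀.1 \ X.1).card := by
  apply le_antisymm
  · have h := bpot_le c T₀ X 1; rwa [rt_one] at h
  · obtain ⟨Q, hQ⟩ := exists_bpot_eq c T₀ X
    rw [hQ]
    rcases ddist_rt_base_cases c T₀ T₁ hbase hc2 hcen Q X with h | h | h | h <;> rw [h] <;> assumption

include hbase in
/-- **`T₀` UNIQUELY nearest**: if `|D|` is STRICTLY smaller than the other three distances, every nearest base change of `X` is `T₀`. [folklore] -/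
theorem unique_T₀_of_lt (hc2 : c * c = 1) (hcen : ∀ x : G, x * c = c * x) (X : CMF G c)
    (h1 : (T₀.1 \ X.1).card < T₀.1.card - (T₀.1 \ X.1).card)
    (h2 : (T₀.1 \ X.1).card < ((T₀.1 \ T₁.1) ∆ (T₀.1 \ X.1)).card)
    (h3 : (T₀.1 \ X.1).card < T₀.1.card - ((T₀.1 \ T₁.1) ∆ (T₀.1 \ X.1)).card) :
    ∀ Q' : G, ddist (rt c Q' T₀) X = bpot c T₀ X → rt c Q' T₀ = rt c (1 : G) T₀ := by
  intro Q' hQ'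
  rw [rt_one]
  rw [bpot_eq_card_dev_of_le c T₀ T₁ hbase hc2 hcen X h1.le h2.le h3.le] at hQ'
  rcases hbase Q' with h | h | h | h
  · exact h
  · exfalso; rw [h, ddist_compl_base_eq c T₀ hc2 hcen] at hQ'; omega
  · exfalso; rw [h, ddist_eq_card_symmDiff c T₀ hc2] at hQ'; omega
  · exfalso; rw [h, ddist_compl_eq c T₀ hc2 hcen] at hQ'; omega

include hbase in
/-- **`T₁` nearest**: if `|𝓗 ∆ D|` is at most the other three distances then `bpot X = |𝓗 ∆ D| = ddist T₁ X`. [folklore] -/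
theorem bpot_eq_card_symmDiff_of_le (hc2 : c * c = 1) (hcen : ∀ x : G, x * c = c * x) (X : CMF G c) {Q₁ : G} (hQ₁ : rt c Q₁ T₀ = T₁)
    (h1 : ((T₀.1 \ T₁.1) ∆ (T₀.1 \ X.1)).card ≤ (T₀.1 \ X.1).card)
    (h2 : ((T₀.1 \ T₁.1) ∆ (T₀.1 \ X.1)).card ≤ T₀.1.card - (T₀.1 \ X.1).card)
    (h3 : ((T₀.1 \ T₁.1) ∆ (T₀.1 \ X.1)).card ≤ T₀.1.card - ((T₀.1 \ T₁.1) ∆ (T₀.1 \ X.1)).card) :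
    bpot c T₀ X = ((T₀.1 \ T₁.1) ∆ (T₀.1 \ X.1)).card := by
  apply le_antisymm
  · have h := bpot_le c T₀ X Q₁; rwa [hQ₁, ddist_eq_card_symmDiff c T₀ hc2] at h
  · obtain ⟨Q, hQ⟩ := exists_bpot_eq c T₀ X
    rw [hQ]
    rcases ddist_rt_base_cases c T₀ T₁ hbase hc2 hcen Q X with h | h | h | h <;> rw [h] <;> assumption

include hbase in
/-- **`T₁` UNIQUELY nearest**: if `|𝓗 ∆ D|` is STRICTLY smaller than the other three distances, every nearest base change of `X` is `T₁ = T₀·Q₁⁻¹`.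
[folklore] -/
theorem unique_T₁_of_lt (hc2 : c * c = 1) (hcen : ∀ x : G, x * c = c * x) (X : CMF G c) {Q₁ : G} (hQ₁ : rt c Q₁ T₀ = T₁)
    (h1 : ((T₀.1 \ T₁.1) ∆ (T₀.1 \ X.1)).card < (T₀.1 \ X.1).card)
    (h2 : ((T₀.1 \ T₁.1) ∆ (T₀.1 \ X.1)).card < T₀.1.card - (T₀.1 \ X.1).card)
    (h3 : ((T₀.1 \ T₁.1) ∆ (T₀.1 \ X.1)).card < T₀.1.card - ((T₀.1 \ T₁.1) ∆ (T₀.1 \ X.1)).card) :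
    ∀ Q' : G, ddist (rt c Q' T₀) X = bpot c T₀ X → rt c Q' T₀ = rt c Q₁ T₀ := by
  intro Q' hQ'
  rw [hQ₁]
  rw [bpot_eq_card_symmDiff_of_le c T₀ T₁ hbase hc2 hcen X hQ₁ h1.le h2.le h3.le] at hQ'
  rcases hbase Q' with h | h | h | h
  · exfalso; rw [h] at hQ'; change (T₀.1 \ X.1).card = _ at hQ'; omega
  · exfalso; rw [h, ddist_compl_base_eq c T₀ hc2 hcen] at hQ'; omega
  · exact h
  · exfalso; rw [h, ddist_compl_eq c T₀ hc2 hcen] at hQ'; omega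

end Four

end

end Summit.HodgeConjecture.CorCM.Census.CentralSquares
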